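import Summits.QuantumFields.YangMills.Theorems.FluctuationComparisonRegPrIntLS2BetaChartReadCurvedOfPlaqSmall
import HarnessLib

/-!
# S2β · (β-3)′ FILE C₅ — THE SIZE OF THE AXIAL GAUGE FUNCTION, AND (β-3)′ AT A PLAQUETTE-SMALL, BOND-SMALL BACKGROUND WITH THE RAW OSCILLATION:
# `dist1 (h x) ≤ (d·2L)·β` for C₄'s two-block axial gauge `h` when every bond variable of `U₀` is within `β` of `1`; hence, by door (γ),
# `‖↑(ψ_{U₀}(X)c) − ↑((Dψ_{U₀}(0)X)c)‖ ≤ 8B·OSC′²∕(a−‖A‖)² + 32B·OSC′·‖A‖∕a² + (ℓ‖A‖)³ + 8·(67ℓ·((d−1)·2L·δ))·‖X‖²∕a²`, `OSC′ = ‖X − A∘dir‖ + 2·((d·2L)·β)·‖X‖`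

Cell `ym3-torus` (YM ladder rung R3 = continuum `SU(2)` Yang–Mills on the three-torus at fixed lattice data — a RUNG: NOT d = 4, NOT infinite volume, NOT a mass gap,
NOT Clay).  Width seat `ym3-torus-px13` (gen 28); crux `stmt-QuantumFields-20520`, LINE g18-1 S2β, pairing lane; (β-3)′ (ARCHITECT RULING px17 g22 19:55:50Z) and its consumer doors
(α)(β)(γ) (21:38:47Z): (β)(γ) = C₃ ✓p835880, (α) docked = C₄ (`…ChartReadCurvedOfPlaqSmall`, the remainder bound for the ORIGINAL pair with the oscillation read in the axial gauge,
`OSC_h = ‖Ad_h X − A∘dir‖`).  THIS FILE removes the last gauge object from the statement: the axial gauge function is itself close to `1` when the background's BOND variables are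
(«stage-axial bond smallness», the lane's `σ_t∕L` class), so `OSC_h ≤ OSC + 2κ_h·M` (door (γ)) with `κ_h = (d·2L)·β` explicit.
`--kind proof --supports stmt-QuantumFields-20520 --as helper`, count-neutral, DEFINITION-FREE (0 `def`, 0 `instance`, 0 `notation`, 0 `sorry`, default heartbeats); generic `P : Params`
(`j + 2 ≤ m + K`), `SU(N)` (§1–§2 for any `GaugeGroup`).

WHAT IS PROVED (sorry-free; `ℓ = (d+2)L`).
§1 ★`dist1_hol_le_length_mul` — `dist1 (V(Γ)) ≤ |Γ|·β` along any word when every bond variable is within `β` of `1` ((19)–(20)).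
§2 `l1_sub_le_of_box`, ★`dist1_axialGauge_le` (lit ✓`T4AxialGaugeSmallField.axialGauge` of ANY box with `hi ≤ lo + n`: `dist1 (h x) ≤ (d·n)·β` everywhere — `1` off the box, a tree
   holonomy of `≤ d·n` bonds on it), ★`dist1_twoBlockAxialGauge_le` (C₄'s two-block box: `≤ (d·2L)·β`), `pi_norm_sub_eq_coe`.
§3 ★★★**`norm_chartRead_sub_fderiv_le_of_plaqSmall_bondSmall`** — hypotheses: global loop guard `∀ c i, dist1 (loopHol U₀ c i) ≤ α`, `4α ≤ ρ ≤ innerRadius`, `0 < ρ`; `PlaqSmall δ U₀`,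
   `100ℓ·((d−1)·2L·δ) ≤ ρ`; `∀ b, dist1 (U₀ b) ≤ β`, `0 ≤ β`; `j + 2 ≤ m + K`; `0 < a`, `100ℓ(e^a − 1) ≤ ρ`; `A : Fin d → 𝔰𝔲(N)`, `8‖A‖ ≤ a`; `X` on the polydisc
   `100ℓ(e^{‖X‖} − 1) ≤ ρ` with `8·OSC′ ≤ a`, `OSC′ = ‖X − A∘dir‖ + 2·((d·2L)·β)·‖X‖`:
   **`‖↑(ψ_{U₀}(X)c) − ↑((Dψ_{U₀}(0)X)c)‖ ≤ 8B·OSC′²∕(a−‖A‖)² + 32B·OSC′·‖A‖∕a² + (ℓ‖A‖)³ + 8·(67ℓ·((d−1)·2L·δ))·‖X‖²∕a²`**, `B = 54ℓ(e^a − 1)` — the (β-3)′ order-2 brick for the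
   ORIGINAL pair, with NO gauge object, NO `κ`: oscillation × amplitude, amplitude² × (plaquette size `δ` and bond size `β`), cubic.  The consumer (c₁ core ∕ G4-i ∕ (SRC)) prices
   `‖X − A∘dir‖` by OSC-LIFT ✓p835228 and feeds `δ = θ_t`-class, `β = σ_t∕L`-class (both summable along the ladder: (E5) ∕ ARC PROFILE).

HONEST.  Bookkeeping over landed engines (C₃ door (γ), C₄, lit `T4AxialGaugeSmallField`, `B7Prop1Explicit.hol`); nothing of Bałaban's analysis is asserted or proved ([Balaban1985Averaging]
(8), (19)–(20), pp.24–25, Prop. 3∕4 cited as SOURCES); OSC pricing, rows' `R`∕`ε`, budgets, (E5), G4-i, (ST‴), (SCT″-c)₁₂₃, LOC‴, GAP♯∘ (`stub_uniformFibreGapOrbit`, registry 3732b7df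
UNTOUCHED, 0∕5), the five REGISTERED stubs, S2β, crux 20520, 19936, 19200, `YM3TorusSU2` — NOT proved; no summit statement is proved by a helper; rung R3 = SU(2) YM₃ on T³ at fixed
lattice data — NOT d = 4, NOT infinite volume, NOT a mass gap, NOT Clay; the Yang–Mills mass gap is NOT proved.  Axioms standard.

References: [Balaban1985Averaging] T. Bałaban, CMP **98** (1985) 17–51, (8), (11)–(13) pp.18–19, (19)–(20) p.21, pp.24–25, Prop. 3 (121)–(125) p.36, Prop. 4 (148)–(149) p.40;
[Balaban1985UV3] CMP **102** (1985) 255–275, (27) p.263; [Balaban1987RG1] CMP **109** (1987) 249–301, (0.1)–(0.4) pp.251–253.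
-/

set_option autoImplicit false

noncomputable section

open scoped Matrix.Norms.L2Operator Topology
open Filter Set Function Metric

namespace Summit.QuantumFields.YangMills.Theorems.FluctuationComparisonRegPrIntLS2BetaChartReadCurvedOfBondSmall

open Literature.MathematicalPhysics.QuantumFieldTheory.Balaban1983to89
open Literature.MathematicalPhysics.QuantumFieldTheory.Balaban1983to89.HaarExponentialChart
open Literature.MathematicalPhysics.QuantumFieldTheory.Balaban1983to89.HaarExponentialChart.IsChartRep
open Literature.MathematicalPhysics.QuantumFieldTheory.Balaban1983to89.BlockAveraging (Small Idx avgFun loopHol off corr)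
open Literature.MathematicalPhysics.QuantumFieldTheory.Balaban1983to89.ExpMeanLog (eml expMeanLogSU deltaSU deltaSU_pos)
open Literature.MathematicalPhysics.QuantumFieldTheory.Balaban1983to89.Node00
open Literature.MathematicalPhysics.QuantumFieldTheory.Balaban1983to89.T4Continuum (walk holAt LStep loopWord)
open Literature.MathematicalPhysics.QuantumFieldTheory.Balaban1983to89.B7Prop1Explicit (hol hol_nil hol_cons stepHol treeWord length_treeWord l1 axialFn)
open Literature.MathematicalPhysics.QuantumFieldTheory.Balaban1983to89.T4AxialGaugeSmallField (castSite castSite_apply boxBonds axialGauge pull pull_apply)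
open Summit.QuantumFields.YangMills.BalabanUVNodes.N09ChartReadAveragingSmooth
open Summit.QuantumFields.YangMills.BalabanUVNodes.N09CentralWindowInjective (norm_coe_SU_le_one)
open Summit.QuantumFields.YangMills.Theorems.FluctuationComparisonRegPrIntLS2BetaChartReadGaugeCovariance
open Summit.QuantumFields.YangMills.Theorems.FluctuationComparisonRegPrIntLS2BetaChartReadCurvedOfPlaqSmall

variable {P : Params} {j : ℕ} {N : ℕ} [NeZero N]

/-! ## §1 Parallel transport along a word is within `|w|·β` of `1` when every bond variable is within `β` of `1` -/

section Hol

variable {d : ℕ} {G : Type*} [GaugeGroup G]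

omit [NeZero N] in
/-- `dist1 (V(Γ)) ≤ |Γ|·β` along any word when `dist1 (V(b)) ≤ β` on every bond ((19)–(20): `|XY − 1| ≤ |X − 1| + |Y − 1|`, `|X⁻¹ − 1| = |X − 1|`).
[cite: Balaban1985Averaging, (19)-(20) p.21] -/
theorem dist1_hol_le_length_mul (V : B7Prop1Explicit.Site d → Fin d → G) {β : ℝ} (hβ : ∀ x μ, dist1 (V x μ) ≤ β) :
    ∀ (x : B7Prop1Explicit.Site d) (w : List (B7Prop1Explicit.Letter d)), dist1 (hol V x w) ≤ (w.length : ℝ) * β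
  | x, [] => by simp [GaugeGroup.dist1_one]
  | x, l :: w => by
    rw [hol_cons, List.length_cons, Nat.cast_succ]
    have hs : dist1 (stepHol V x l) ≤ β := by
      unfold stepHol
      split_ifs
      · exact hβ _ _
      · rw [GaugeGroup.dist1_inv]; exact hβ _ _
    have ih := dist1_hol_le_length_mul V hβ (x + l.vec) w
    calc _ ≤ dist1 (stepHol V x l) + dist1 (hol V (x + l.vec) w) := GaugeGroup.dist1_mul_le _ _
      _ ≤ β + (w.length : ℝ) * β := add_le_add hs ih
      _ = ((w.length : ℝ) + 1) * β := by ring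

end Hol

/-! ## §2 The axial gauge function of the two-block box is within `(d·2L)·β` of `1` everywhere -/

section GaugeSize

omit [NeZero N] in
/-- `|x − lo|₁ ≤ d·n` inside a box with `hi ≤ lo + n`. [folklore] -/
theorem l1_sub_le_of_box {lo hi x : Fin P.d → ℤ} {n : ℕ} (hn : ∀ κ, hi κ ≤ lo κ + n) (hlo : lo ≤ x) (hhi : x ≤ hi) :
    l1 (x - lo) ≤ P.d * n := by
  unfold l1
  calc ∑ κ, ((x - lo) κ).natAbs ≤ ∑ _κ : Fin P.d, n := Finset.sum_le_sum fun κ _ => by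
          have h1 : 0 ≤ (x - lo) κ := by have := hlo κ; simp only [Pi.sub_apply]; linarith
          have h2 : (x - lo) κ ≤ n := by have := hhi κ; have := hn κ; simp only [Pi.sub_apply]; linarith
          omega
    _ = P.d * n := by simp

/-- ★ **THE AXIAL GAUGE FUNCTION IS WITHIN `(d·n)·β` OF `1` EVERYWHERE**: `1` off the box, a tree holonomy of `≤ d·n` bonds on it. [cite: Balaban1985Averaging, (8) p.18, (19)-(20) p.21] -/
theorem dist1_axialGauge_le {G : Type*} [GaugeGroup G] (U : GaugeField P j G) {lo hi : Fin P.d → ℤ} {n : ℕ} (hn : ∀ κ, hi κ ≤ lo κ + n)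
    {β : ℝ} (hβ0 : 0 ≤ β) (hβ : ∀ b : PBond P j, dist1 (U b) ≤ β) (s : Site P j) :
    dist1 (axialGauge U lo hi s) ≤ ((P.d * n : ℕ) : ℝ) * β := by
  unfold axialGauge
  split_ifs with h
  · obtain ⟨hlo, hhi, -⟩ := Classical.choose_spec h
    unfold axialFn
    refine (dist1_hol_le_length_mul (pull U) (fun x μ => by rw [pull_apply]; exact hβ _) lo _).trans ?_
    rw [length_treeWord]
    exact mul_le_mul_of_nonneg_right (by exact_mod_cast l1_sub_le_of_box hn hlo hhi) hβ0
  · rw [GaugeGroup.dist1_one]; positivity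

/-- ★ **THE TWO-BLOCK AXIAL GAUGE FUNCTION IS WITHIN `(d·2L)·β` OF `1`** (C₄'s box: `2L+1` sites per direction). [cite: Balaban1985Averaging, (8) p.18, pp.24-25] -/
theorem dist1_twoBlockAxialGauge_le (U₀ : GaugeField P j (SU N)) (c : PBond P (j + 1)) {β : ℝ} (hβ0 : 0 ≤ β) (hβ : ∀ b : PBond P j, dist1 (U₀ b) ≤ β) (s : Site P j) :
    dist1 ((T4AxialGaugeSmallField.axialGauge U₀ (fun κ : Fin P.d => (((emb c.src κ).val : ℕ) : ℤ) - (((P.L - 1) / 2 : ℕ) : ℤ)) (fun κ : Fin P.d => (((emb c.src κ).val : ℕ) : ℤ) + ((if c.dir = κ then (P.L : ℤ) else 0) + (((P.L - 1) / 2 : ℕ) : ℤ)) + 1)) s) ≤ (((P.d * (2 * P.L) : ℕ) : ℝ) * β) :=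
  dist1_axialGauge_le U₀ (hi_le_lo_add (P := P) c) hβ0 hβ s

end GaugeSize

/-- The sup norm of a difference of `𝔰𝔲(N)`-valued bond fields is the sup norm of the difference of their matrices. [folklore] -/
theorem pi_norm_sub_eq_coe (F G : PBond P j → (specialUnitaryLogChart (Fin N)).lie) :
    ‖F - G‖ = ‖(fun b => ((F b : (specialUnitaryLogChart (Fin N)).lie) : Matrix (Fin N) (Fin N) ℂ)) - (fun b => ((G b : (specialUnitaryLogChart (Fin N)).lie) : Matrix (Fin N) (Fin N) ℂ))‖ := by
  refine le_antisymm ((pi_norm_le_iff_of_nonneg (norm_nonneg _)).2 fun b => ?_) ((pi_norm_le_iff_of_nonneg (norm_nonneg _)).2 fun b => ?_)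
  · have h := norm_le_pi_norm ((fun b => ((F b : (specialUnitaryLogChart (Fin N)).lie) : Matrix (Fin N) (Fin N) ℂ)) - (fun b => ((G b : (specialUnitaryLogChart (Fin N)).lie) : Matrix (Fin N) (Fin N) ℂ))) b
    rw [Pi.sub_apply] at h ⊢
    rwa [← Submodule.norm_coe, Submodule.coe_sub]
  · have h := norm_le_pi_norm (F - G) b
    rw [Pi.sub_apply] at h ⊢
    rwa [← Submodule.norm_coe, Submodule.coe_sub] at h

/-! ## §3 ★★★ (β-3)′ at a plaquette-small, bond-small background with the RAW oscillation -/

section Main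

/-- ★★★ **(β-3)′, GAUGE-FREE, RAW OSCILLATION.**  For `U₀` in the loop `α`-guard at every coarse bond (`4α ≤ ρ ≤ innerRadius`, `0 < ρ`), `PlaqSmall δ U₀` with `100ℓ·((d−1)·2L·δ) ≤ ρ`,
every bond variable within `β` of `1`, `j + 2 ≤ m + K`; a radius `0 < a`, `100ℓ(e^a − 1) ≤ ρ`; `A : Fin d → 𝔰𝔲(N)` with `8‖A‖ ≤ a`; and a direction `X` on the polydisc with
`8·OSC′ ≤ a`, `OSC′ := ‖X − A∘dir‖ + 2·((d·2L)·β)·‖X‖`: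
`‖↑(ψ_{U₀}(X)c) − ↑((Dψ_{U₀}(0)X)c)‖ ≤ 8B·OSC′²∕(a−‖A‖)² + 32B·OSC′·‖A‖∕a² + (ℓ‖A‖)³ + 8·(67ℓ·((d−1)·2L·δ))·‖X‖²∕a²`, `B = 54ℓ(e^a − 1)`
(C₄ ✓`norm_chartRead_sub_fderiv_le_of_plaqSmall` + door (γ) C₃ ✓`norm_conjField_sub_le` with §2's `κ_h = (d·2L)·β`).
[cite: Balaban1985Averaging, (8), (11)-(13) pp.18-19, pp.24-25, Prop. 3 (121)-(125) p.36, Prop. 4 (148)-(149) p.40; Balaban1987RG1, (0.3)-(0.4) pp.252-253] -/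
theorem norm_chartRead_sub_fderiv_le_of_plaqSmall_bondSmall (hj2 : j + 2 ≤ P.m + P.K) (U₀ : GaugeField P j (SU N)) {α ρ : ℝ} (hρ0 : 0 < ρ)
    (hρ : ρ ≤ innerRadius (specialUnitaryLogChart (Fin N))) (hα : ∀ c i, dist1 (loopHol U₀ c i) ≤ α) (hα4 : 4 * α ≤ ρ)
    {δ : ℝ} (hδ : 0 ≤ δ) (hU : PlaqSmall δ U₀) (hκℓ : 100 * ((((P.d + 2) * P.L : ℕ) : ℝ) * (((P.d - 1 : ℕ) : ℝ) * ((2 * P.L : ℕ) : ℝ) * δ)) ≤ ρ)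
    {β : ℝ} (hβ0 : 0 ≤ β) (hβ : ∀ b : PBond P j, dist1 (U₀ b) ≤ β) (c : PBond P (j + 1))
    {a : ℝ} (ha0 : 0 < a) (ha : 100 * ((((P.d + 2) * P.L : ℕ) : ℝ) * (Real.exp a - 1)) ≤ ρ)
    (A : Fin P.d → (specialUnitaryLogChart (Fin N)).lie) (hAa : 8 * ‖A‖ ≤ a)
    (X : PBond P j → (specialUnitaryLogChart (Fin N)).lie) (hX : 100 * ((((P.d + 2) * P.L : ℕ) : ℝ) * (Real.exp ‖X‖ - 1)) ≤ ρ)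
    (hXA : 8 * (‖X - (fun b => A b.dir)‖ + 2 * (((P.d * (2 * P.L) : ℕ) : ℝ) * β) * ‖X‖) ≤ a) :
    ‖(((isChartRep_specialUnitaryGroup (n := Fin N)).logChart (avgFun (expMeanLogSU (n := Fin N)) (fun b => (isChartRep_specialUnitaryGroup (n := Fin N)).expChart (X b) * U₀ b) c * (avgFun (expMeanLogSU (n := Fin N)) U₀ c)⁻¹) : (specialUnitaryLogChart (Fin N)).lie) : Matrix (Fin N) (Fin N) ℂ) -
        (((fderiv ℝ (fun (A : PBond P j → (specialUnitaryLogChart (Fin N)).lie) (c : PBond P (j + 1)) => (isChartRep_specialUnitaryGroup (n := Fin N)).logChart (avgFun (expMeanLogSU (n := Fin N)) (fun b => (isChartRep_specialUnitaryGroup (n := Fin N)).expChart (A b) * U₀ b) c * (avgFun (expMeanLogSU (n := Fin N)) U₀ c)⁻¹)) 0 X) c : (specialUnitaryLogChart (Fin N)).lie) : Matrix (Fin N) (Fin N) ℂ)‖ ≤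
      8 * (54 * ((((P.d + 2) * P.L : ℕ) : ℝ) * (Real.exp a - 1))) * (‖X - (fun b => A b.dir)‖ + 2 * (((P.d * (2 * P.L) : ℕ) : ℝ) * β) * ‖X‖) ^ 2 / (a - ‖A‖) ^ 2 +
        32 * (54 * ((((P.d + 2) * P.L : ℕ) : ℝ) * (Real.exp a - 1))) * (‖X - (fun b => A b.dir)‖ + 2 * (((P.d * (2 * P.L) : ℕ) : ℝ) * β) * ‖X‖) * ‖A‖ / a ^ 2 +
        ((((P.d + 2) * P.L : ℕ) : ℝ) * ‖A‖) ^ 3 + 8 * (67 * ((((P.d + 2) * P.L : ℕ) : ℝ) * (((P.d - 1 : ℕ) : ℝ) * ((2 * P.L : ℕ) : ℝ) * δ))) * ‖X‖ ^ 2 / a ^ 2 := by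
  set h : GaugeTransf P j (SU N) := (T4AxialGaugeSmallField.axialGauge U₀ (fun κ : Fin P.d => (((emb c.src κ).val : ℕ) : ℤ) - (((P.L - 1) / 2 : ℕ) : ℤ)) (fun κ : Fin P.d => (((emb c.src κ).val : ℕ) : ℤ) + ((if c.dir = κ then (P.L : ℤ) else 0) + (((P.L - 1) / 2 : ℕ) : ℤ)) + 1)) with hh
  -- door (γ): the gauged oscillation against the raw one
  have hκh : ∀ s : Site P j, dist1 (h s) ≤ (((P.d * (2 * P.L) : ℕ) : ℝ) * β) := fun s => by rw [hh]; exact dist1_twoBlockAxialGauge_le U₀ c hβ0 hβ s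
  have hK0 : 0 ≤ (((P.d * (2 * P.L) : ℕ) : ℝ) * β) := by positivity
  have hosc : ‖(fun b : PBond P j => ((h b.src : SU N) : Matrix (Fin N) (Fin N) ℂ) * ((fun b => ((X b : (specialUnitaryLogChart (Fin N)).lie) : Matrix (Fin N) (Fin N) ℂ)) b) * star ((h b.src : SU N) : Matrix (Fin N) (Fin N) ℂ)) -
      (fun b => (((fun b => A b.dir) b : (specialUnitaryLogChart (Fin N)).lie) : Matrix (Fin N) (Fin N) ℂ))‖ ≤
      ‖(fun b => ((X b : (specialUnitaryLogChart (Fin N)).lie) : Matrix (Fin N) (Fin N) ℂ)) - (fun b => (((fun b => A b.dir) b : (specialUnitaryLogChart (Fin N)).lie) : Matrix (Fin N) (Fin N) ℂ))‖ + 2 * (((P.d * (2 * P.L) : ℕ) : ℝ) * β) * ‖(fun b => ((X b : (specialUnitaryLogChart (Fin N)).lie) : Matrix (Fin N) (Fin N) ℂ))‖ :=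
    norm_conjField_sub_le h hK0 hκh _ _
  -- the Lie-valued norms are the matrix norms
  have hcoeX : ‖(fun b => ((X b : (specialUnitaryLogChart (Fin N)).lie) : Matrix (Fin N) (Fin N) ℂ))‖ ≤ ‖X‖ := FluctuationComparisonRegPrIntLS2BetaChartReadCplxAnalytic.norm_coePi_le X
  have hraw : ‖(fun b => ((X b : (specialUnitaryLogChart (Fin N)).lie) : Matrix (Fin N) (Fin N) ℂ)) - (fun b => (((fun b => A b.dir) b : (specialUnitaryLogChart (Fin N)).lie) : Matrix (Fin N) (Fin N) ℂ))‖ = ‖X - (fun b => A b.dir)‖ :=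
    (pi_norm_sub_eq_coe X (fun b => A b.dir)).symm
  have hgauged : ‖(fun b : PBond P j => (⟨((h b.src : SU N) : Matrix (Fin N) (Fin N) ℂ) * ((X b : (specialUnitaryLogChart (Fin N)).lie) : Matrix (Fin N) (Fin N) ℂ) * star ((h b.src : SU N) : Matrix (Fin N) (Fin N) ℂ), conj_mem_lie (h b.src) (X b)⟩ : (specialUnitaryLogChart (Fin N)).lie)) - (fun b => A b.dir)‖ =
      ‖(fun b : PBond P j => ((h b.src : SU N) : Matrix (Fin N) (Fin N) ℂ) * ((fun b => ((X b : (specialUnitaryLogChart (Fin N)).lie) : Matrix (Fin N) (Fin N) ℂ)) b) * star ((h b.src : SU N) : Matrix (Fin N) (Fin N) ℂ)) - (fun b => (((fun b => A b.dir) b : (specialUnitaryLogChart (Fin N)).lie) : Matrix (Fin N) (Fin N) ℂ))‖ :=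
    pi_norm_sub_eq_coe _ _
  have hOSC : ‖(fun b : PBond P j => (⟨((h b.src : SU N) : Matrix (Fin N) (Fin N) ℂ) * ((X b : (specialUnitaryLogChart (Fin N)).lie) : Matrix (Fin N) (Fin N) ℂ) * star ((h b.src : SU N) : Matrix (Fin N) (Fin N) ℂ), conj_mem_lie (h b.src) (X b)⟩ : (specialUnitaryLogChart (Fin N)).lie)) - (fun b => A b.dir)‖ ≤ ‖X - (fun b => A b.dir)‖ + 2 * (((P.d * (2 * P.L) : ℕ) : ℝ) * β) * ‖X‖ := by
    rw [hgauged]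
    refine hosc.trans ?_
    rw [hraw]
    have := mul_le_mul_of_nonneg_left hcoeX (by positivity : (0 : ℝ) ≤ 2 * (((P.d * (2 * P.L) : ℕ) : ℝ) * β))
    linarith
  have hXA' : 8 * ‖(fun b : PBond P j => (⟨((h b.src : SU N) : Matrix (Fin N) (Fin N) ℂ) * ((X b : (specialUnitaryLogChart (Fin N)).lie) : Matrix (Fin N) (Fin N) ℂ) * star ((h b.src : SU N) : Matrix (Fin N) (Fin N) ℂ), conj_mem_lie (h b.src) (X b)⟩ : (specialUnitaryLogChart (Fin N)).lie)) - (fun b => A b.dir)‖ ≤ a := by linarith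
  have hC := norm_chartRead_sub_fderiv_le_of_plaqSmall hj2 U₀ hρ0 hρ hα hα4 hδ hU hκℓ c ha0 ha A hAa X hX hXA'
  refine hC.trans ?_
  -- monotonicity of the bound in the oscillation
  have hB0 : 0 ≤ 54 * ((((P.d + 2) * P.L : ℕ) : ℝ) * (Real.exp a - 1)) := by
    have : 0 ≤ Real.exp a - 1 := by linarith [Real.add_one_le_exp a]
    positivity
  have hAlt : ‖A‖ < a := by linarith [norm_nonneg A]
  have h1 := FluctuationComparisonRegPrIntLS2BetaChartReadOscSplit.cauchy_bound_mono (a := a) (nu := ‖A‖) (nu' := ‖A‖) hB0 (norm_nonneg _) hOSC le_rfl hAlt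
  have h2 : 32 * (54 * ((((P.d + 2) * P.L : ℕ) : ℝ) * (Real.exp a - 1))) * ‖(fun b : PBond P j => (⟨((h b.src : SU N) : Matrix (Fin N) (Fin N) ℂ) * ((X b : (specialUnitaryLogChart (Fin N)).lie) : Matrix (Fin N) (Fin N) ℂ) * star ((h b.src : SU N) : Matrix (Fin N) (Fin N) ℂ), conj_mem_lie (h b.src) (X b)⟩ : (specialUnitaryLogChart (Fin N)).lie)) - (fun b => A b.dir)‖ * ‖A‖ / a ^ 2 ≤
      32 * (54 * ((((P.d + 2) * P.L : ℕ) : ℝ) * (Real.exp a - 1))) * (‖X - (fun b => A b.dir)‖ + 2 * (((P.d * (2 * P.L) : ℕ) : ℝ) * β) * ‖X‖) * ‖A‖ / a ^ 2 := by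
    refine div_le_div_of_nonneg_right ?_ (pow_pos ha0 2).le
    exact mul_le_mul_of_nonneg_right (mul_le_mul_of_nonneg_left hOSC (by positivity)) (norm_nonneg A)
  linarith

end Main

end Summit.QuantumFields.YangMills.Theorems.FluctuationComparisonRegPrIntLS2BetaChartReadCurvedOfBondSmall

end
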